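/-
Copyright (c) 2026 the pub-hodgecm-mathlib formalisation cell (harness21).  Prover seat hodgecm-mathlib-K2E1-p09 (g6), Track B ∕ K2-LIT, h413 =
`stmt-HodgeConjecture-24833`, ENGINE E1, campaign «EIS-R7-BL-SPH-3» (the `N = 3` clone), deal of the dealer K2E1-plan (g5) 2026-09-04T09:30:21Z
(«`K2E1BLUniquenessU3` = ONLY the rank-specific lemmas P6′₃ (iv) will need»).
-/
import Summits.HodgeConjecture.HodgeConjecture.Theorems.K2E1BLUniquenessU2      -- ★ p858816 (K2-defs1 g5) P6: the RANK-GENERIC heads `tendsto_integral_mul_borelHeight_rpow_atTop`, `exists_testFunction_forall_exists_lt_norm`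
import Summits.HodgeConjecture.HodgeConjecture.Theorems.K2E1BLHeightCosetsU3   -- ★ p858853 (K2E1-p02 g6) BL-R1₃: `exists_torus_posRealIdele_three` (the `N = 3` torus ray)
import Summits.HodgeConjecture.HodgeConjecture.Theorems.K2E1BLUniquenessSelfAdjointU2   -- ★ p858990 (K2E1-p02 g6) P6′: `exists_mem_im_ne_zero_of_differentiable`, `not_forall_eq_of_tendsto_atTop` (ED. 2)
import HarnessLib

/-!
# K2·E1 — `K2E1BLUniquenessU3` («EIS-R7-BL-SPH-3»): `1 ∈ closure {H > 1}` ON `U(J₃)(𝔸_F)` BY THE TORUS RAY `diag(z_E(e^s), 1, z_E(e^{−s}))`, AND THE HYPOTHESIS-FREE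
# BERNSTEIN–LAPID TEST FUNCTION AT `N = 3` (`ĥ(z₀) ≠ 0`, `|ĥ(σ)| → ∞`)

Track B ∕ K2-LIT, crux h413 = `stmt-HodgeConjecture-24833`, route of record `HCCMUnconditional`; cell `hodgecm-mathlib`, squad K2, ENGINE E1 (campaign «EIS-R7-BL», the BL-SPH-3
clone; (ζ′) WIRING 7d1cceb628a30de8 §4).  Prover seat `hodgecm-mathlib-K2E1-p09` (g6).  THEOREMS ONLY (no `def`, no `instance`, no notation, no named-fact hypothesis, no `sorry`;
default heartbeats); lane `--supports stmt-HodgeConjecture-24833 --as helper` (count-neutral).  Closes no socket.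

THE MATHEMATICS [BernsteinLapid2019, Thm 2.3, §4 Claims 1–2 (p. 9); Borel1963, §5].  ★ P6 `K2E1BLUniquenessU2` is RANK-GENERIC except for one input: `1 ∈ closure {g ∣ H(g) > 1}`
(so that a bi-`K_U`-invariant bump `h ≥ 0` at `1` sees a point of height `> 1`, whence `ĥ(σ) = ∫ h·H^σ → ∞`, ★ `tendsto_integral_mul_borelHeight_rpow_atTop`).  At `N = 3` the
archimedean torus ray `t_s := diag(z_E(e^s), 1, z_E(e^s)⁻¹) ∈ T(𝔸_F)` (★ BL-R1₃ `exists_torus_posRealIdele_three`; NO `c² = 1` needed — the middle entry is `1`) has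
`H(t_s) = e^{s[E:ℚ]}·H(1) = e^{s[E:ℚ]} > 1` for `s > 0` and `t_s → 1` as `s → 0⁺` (`G(𝔸_F) ↪ GL₃(𝔸_E)` is a closed embedding and the diagonal ray is continuous, the device of ★ R1₃
:156).  Hence (§2) ★ P6's closing corollary at `N = 3`, hypothesis-free: for `μ` finite on compacta and positive on opens and every `z₀`, a continuous compactly supported
bi-`K_U`-invariant `h ≥ 0` with `ĥ(z₀) ≠ 0` and `∀ σ₁ M, ∃ σ > σ₁, M < |ĥ(σ)|`.

* §1 **`one_mem_closure_setOf_one_lt_borelHeight_three`**.   §2 **`exists_testFunction_forall_exists_lt_norm_three`**, **`exists_testFunction_forall_exists_lt_norm_cm_three`**.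
(`tendsto_integral_mul_borelHeight_rpow_atTop_three` of the deal = ★ P6's rank-generic `tendsto_integral_mul_borelHeight_rpow_atTop` at `N = 3` — cited, not restated.)
HONEST LABEL: HC_CM is proved only modulo the 7 printed citations (2 remaining named inputs: hLiu418 = `stmt-HodgeConjecture-24832`, h413 = `stmt-HodgeConjecture-24833`) until rung 0
closes; this file asserts no named fact and closes no socket; count-neutral.

## References
* [BernsteinLapid2019] J. Bernstein, E. Lapid, *On the meromorphic continuation of Eisenstein series*, J. Amer. Math. Soc. 37 (2024) (arXiv:1911.02342): Thm 2.3, §4 Claims 1–2.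
* [Borel1963] A. Borel, *Some finiteness properties of adele groups over number fields*, Publ. Math. IHÉS 16 (1963): §5.
-/

set_option autoImplicit false
set_option linter.dupNamespace false  -- the mandated namespace repeats the summit's segment (`HodgeConjecture.HodgeConjecture`)

noncomputable section

open MeasureTheory Measure NumberField IsDedekindDomain Set Filter Matrix Topology
open scoped ENNReal NNReal MatrixGroups
open Literature.NumberTheory Literature.NumberTheory.Automorphic Literature.NumberTheory.Automorphic.UnitaryGroup
open AdelicGroupData
open Summit.HodgeConjecture.HodgeConjecture.Cruxes.H413.K2E1HeightFunctionU3 (borelHeight_one)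
open Summit.HodgeConjecture.HodgeConjecture.Cruxes.H413.K2E1BLHeightCosetsU3 (exists_torus_posRealIdele_three)
open Summit.HodgeConjecture.HodgeConjecture.Cruxes.H413.K2E1BLUniquenessU2 (exists_testFunction_forall_exists_lt_norm)

namespace Summit.HodgeConjecture.HodgeConjecture.Cruxes.H413.K2E1BLUniquenessU3

variable {F E : Type} [Field F] [NumberField F] [Field E] [NumberField E] [Algebra F E] {c : E ≃ₐ[F] E}

/-! ## §1 `1 ∈ closure {H > 1}` on `U(J₃)(𝔸_F)` -/

/-- **`1 ∈ closure {H > 1}` on `U(J₃)(𝔸_F)`**: `t_s = diag(z_E(e^s), 1, z_E(e^s)⁻¹)` (★ BL-R1₃ `exists_torus_posRealIdele_three`) has `H(t_s) = e^{s[E:ℚ]} > 1` for `s > 0` and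
`t_s → 1` as `s → 0⁺` (closed embedding `G(𝔸_F) ↪ GL₃(𝔸_E)`).  The `N = 3` twin of ★ P6 `one_mem_closure_setOf_one_lt_borelHeight_two`, without `c² = 1`.
[cite: BernsteinLapid2019, §4 Claim 2 (p. 9)] [cite: Borel1963, §5] -/
theorem one_mem_closure_setOf_one_lt_borelHeight_three : (1 : (quasiSplit F E c 3).Adelic) ∈ closure {g : (quasiSplit F E c 3).Adelic | 1 < borelHeight g} := by
  classical
  choose t ht using fun r : ℝ≥0ˣ => exists_torus_posRealIdele_three (F := F) (E := E) (c := c) r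
  set f : ℝ → (quasiSplit F E c 3).Adelic := fun s => ((t (expUnitNNReal s) : borelAdelic F E c 3) : (quasiSplit F E c 3).Adelic) with hf
  have hCE : Topology.IsClosedEmbedding ⇑(adelicVal F E c 3 ((StdForm.antidiagonal 3).over E)) :=
    (isClosed_adelic F E c 3 ((StdForm.antidiagonal 3).over E)).isClosedEmbedding_subtypeVal
  have hval : ∀ s, adelicVal F E c 3 ((StdForm.antidiagonal 3).over E) (f s) =
      glDiagonal 3 (AdeleRing (𝓞 E) E) ![posRealIdele E (expUnitNNReal s), 1, posRealIdele E (expUnitNNReal s)⁻¹] :=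
    fun s => (ht _).1
  have hray : Continuous fun s : ℝ => glDiagonal 3 (AdeleRing (𝓞 E) E) ![posRealIdele E (expUnitNNReal s), 1, posRealIdele E (expUnitNNReal s)⁻¹] := by
    refine (continuous_glDiagonal (n := 3) (AdeleRing (𝓞 E) E)).comp (continuous_pi fun i => ?_)
    match i with
    | ⟨0, _⟩ => exact (continuous_posRealIdele E).comp continuous_expUnitNNReal
    | ⟨1, _⟩ => exact continuous_const
    | ⟨2, _⟩ => exact (continuous_posRealIdele E).comp continuous_expUnitNNReal.inv
  have hfc : Continuous f := by
    rw [hCE.isInducing.continuous_iff]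
    exact hray.congr fun s => by simp only [Function.comp_apply, hval]
  have hone : (![(1 : (AdeleRing (𝓞 E) E)ˣ), 1, 1] : Fin 3 → (AdeleRing (𝓞 E) E)ˣ) = 1 := by funext i; fin_cases i <;> rfl
  have hf0 : f 0 = 1 := hCE.injective (by rw [hval, map_one, expUnitNNReal_zero, inv_one, map_one, hone, map_one])
  have htend : Tendsto f (𝓝[>] (0 : ℝ)) (𝓝 1) := by rw [← hf0]; exact (hfc.tendsto 0).mono_left nhdsWithin_le_nhds
  refine mem_closure_of_tendsto htend (eventually_nhdsWithin_of_forall fun s hs => ?_)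
  have hH := (ht (expUnitNNReal s)).2 1
  rw [mul_one, borelHeight_one, mul_one] at hH
  show 1 < borelHeight (f s)
  rw [hH]
  refine one_lt_pow₀ ?_ Module.finrank_pos.ne'
  have h1 : (1 : ℝ) < (((expUnitNNReal s : ℝ≥0ˣ) : ℝ≥0) : ℝ) := by rw [coe_expUnitNNReal]; exact Real.one_lt_exp_iff.2 hs
  exact_mod_cast h1

/-! ## §2 The hypothesis-free Bernstein–Lapid test function at `N = 3` -/

variable [MeasurableSpace (quasiSplit F E c 3).Adelic] [BorelSpace (quasiSplit F E c 3).Adelic]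

/-- **(BL-P6₃) HYPOTHESIS-FREE AT `N = 3`**: for `μ` finite on compacta and positive on opens (Haar) and every `z₀` there is a continuous, compactly supported, non-negative,
bi-`K_U`-invariant `h` with `ĥ(z₀) ≠ 0` and `∀ σ₁ M, ∃ σ > σ₁` real, `M < |ĥ(σ)|` (★ P6's generic `exists_testFunction_forall_exists_lt_norm` + §1).
[cite: BernsteinLapid2019, Thm 2.3 and §4 Claims 1–2] -/
theorem exists_testFunction_forall_exists_lt_norm_three (μ : Measure (quasiSplit F E c 3).Adelic) [IsFiniteMeasureOnCompacts μ] [μ.IsOpenPosMeasure] (z₀ : ℂ) :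
    ∃ h : (quasiSplit F E c 3).Adelic → ℝ, Continuous h ∧ HasCompactSupport h ∧ (∀ x, 0 ≤ h x) ∧ (∀ k₁ k₂ : (quasiSplit F E c 3).Adelic,
        adelicVal F E c 3 ((StdForm.antidiagonal 3).over E) k₁ ∈ standardMaximalCompactGL 3 E →
        adelicVal F E c 3 ((StdForm.antidiagonal 3).over E) k₂ ∈ standardMaximalCompactGL 3 E → ∀ x, h (k₁ * x * k₂) = h x) ∧
      (∫ x, (h x : ℂ) * (((borelHeight x : ℝ≥0) : ℝ) : ℂ) ^ z₀ ∂μ) ≠ 0 ∧ ∀ σ₁ M : ℝ, ∃ σ : ℝ, σ₁ < σ ∧ M < ‖∫ x, (h x : ℂ) * (((borelHeight x : ℝ≥0) : ℝ) : ℂ) ^ (σ : ℂ) ∂μ‖ :=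
  exists_testFunction_forall_exists_lt_norm μ one_mem_closure_setOf_one_lt_borelHeight_three z₀

/-- **The CM packaging** (`F = L⁺`, `E = L`, `c` = complex conjugation): the same, hypothesis-free, at `N = 3`. [cite: BernsteinLapid2019, Thm 2.3 and §4 Claims 1–2] -/
theorem exists_testFunction_forall_exists_lt_norm_cm_three (L : Type) [Field L] [NumberField L] [IsCMField L]
    [MeasurableSpace (quasiSplit (↥(maximalRealSubfield L)) L (IsCMField.complexConj L) 3).Adelic] [BorelSpace (quasiSplit (↥(maximalRealSubfield L)) L (IsCMField.complexConj L) 3).Adelic]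
    (μ : Measure (quasiSplit (↥(maximalRealSubfield L)) L (IsCMField.complexConj L) 3).Adelic) [IsFiniteMeasureOnCompacts μ] [μ.IsOpenPosMeasure] (z₀ : ℂ) :
    ∃ h : (quasiSplit (↥(maximalRealSubfield L)) L (IsCMField.complexConj L) 3).Adelic → ℝ, Continuous h ∧ HasCompactSupport h ∧ (∀ x, 0 ≤ h x) ∧
      (∀ k₁ k₂ : (quasiSplit (↥(maximalRealSubfield L)) L (IsCMField.complexConj L) 3).Adelic,
        adelicVal (↥(maximalRealSubfield L)) L (IsCMField.complexConj L) 3 ((StdForm.antidiagonal 3).over L) k₁ ∈ standardMaximalCompactGL 3 L →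
        adelicVal (↥(maximalRealSubfield L)) L (IsCMField.complexConj L) 3 ((StdForm.antidiagonal 3).over L) k₂ ∈ standardMaximalCompactGL 3 L → ∀ x, h (k₁ * x * k₂) = h x) ∧
      (∫ x, (h x : ℂ) * (((borelHeight x : ℝ≥0) : ℝ) : ℂ) ^ z₀ ∂μ) ≠ 0 ∧ ∀ σ₁ M : ℝ, ∃ σ : ℝ, σ₁ < σ ∧ M < ‖∫ x, (h x : ℂ) * (((borelHeight x : ℝ≥0) : ℝ) : ℂ) ^ (σ : ℂ) ∂μ‖ :=
  exists_testFunction_forall_exists_lt_norm_three μ z₀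


/-! ## §3 (ED. 2) The self-adjoint uniqueness set with an ARBITRARY real threshold `σ₀` (rank `N`; dealer «(b) =» 09:33:42Z), and the `N = 2 ∕ 3` one-liners -/

section UniqueSetThreshold

open Metric
open Summit.HodgeConjecture.HodgeConjecture.Cruxes.H413.K2E1BLUniquenessU2 (integral_ofReal_mul_cpow_ofReal tendsto_integral_mul_borelHeight_rpow_atTop exists_ne_zero_one_lt_borelHeight
  one_mem_closure_setOf_one_lt_borelHeight_two)
open Summit.HodgeConjecture.HodgeConjecture.Cruxes.H413.K2E1BLUniquenessSelfAdjointU2 (exists_mem_im_ne_zero_of_differentiable not_forall_eq_of_tendsto_atTop)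
open Summit.HodgeConjecture.HodgeConjecture.Cruxes.H413.K2E1SphericalHeckeEigenSectionU2 (differentiable_integral_mul_borelHeight_cpow)

variable {N : ℕ} [NeZero N] [MeasurableSpace (quasiSplit F E c N).Adelic] [BorelSpace (quasiSplit F E c N).Adelic]

omit [MeasurableSpace (quasiSplit F E c 3).Adelic] [BorelSpace (quasiSplit F E c 3).Adelic] in
/-- **`U₀(σ₀, n) := ball 0 (n + 2) ∩ {σ₀ < Re z} ∩ {Im ĥ(z) ≠ 0}` IS NON-EMPTY for EVERY real threshold `σ₀ < n + 2`** (rank `N`; ★ P6′ `uniqueSetSA_nonempty` is `σ₀ = 1`):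
`h ≥ 0` continuous of compact support with `h(g₀) ≠ 0` at a point of height `> 1`, `μ_G` finite on compacts and positive on opens ⟹ `ĥ` is entire and `→ +∞` along the reals (★
`tendsto_integral_mul_borelHeight_rpow_atTop`), hence non-constant, hence takes a non-real value on the non-empty open `ball 0 (n+2) ∩ {σ₀ < Re}` (★ `exists_mem_im_ne_zero_of_differentiable`;
witness: the real midpoint of `max(σ₀, −(n+2))` and `n + 2`).  At `N = 3` the existence abscissa is `2 < Re z` (`2ρ_B = 2`): the closer takes `σ₀ = 2`. [cite: BernsteinLapid2019, §4 Claim 1 and Thm 2.3] -/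
theorem uniqueSetSA_nonempty_of_lt (μG : Measure (quasiSplit F E c N).Adelic) [IsFiniteMeasureOnCompacts μG] [μG.IsOpenPosMeasure]
    {h : (quasiSplit F E c N).Adelic → ℝ} (hh : Continuous h) (hhs : HasCompactSupport h) (h0 : ∀ x, 0 ≤ h x)
    {g₀ : (quasiSplit F E c N).Adelic} (hg₀ : h g₀ ≠ 0) (hH : 1 < borelHeight g₀) (σ₀ : ℝ) (n : ℕ) (hσ₀ : σ₀ < n + 2) :
    (ball (0 : ℂ) (n + 2) ∩ {z : ℂ | σ₀ < z.re} ∩ {z : ℂ | (∫ x, (h x : ℂ) * (((borelHeight x : ℝ≥0) : ℝ) : ℂ) ^ z ∂μG).im ≠ 0}).Nonempty := by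
  have hhc : Continuous fun x => (h x : ℂ) := Complex.continuous_ofReal.comp hh
  have hhsc : HasCompactSupport fun x => (h x : ℂ) := hhs.comp_left Complex.ofReal_zero
  have hent := differentiable_integral_mul_borelHeight_cpow μG hhc hhsc
  have hnc := not_forall_eq_of_tendsto_atTop (f := fun z : ℂ => ∫ x, (h x : ℂ) * (((borelHeight x : ℝ≥0) : ℝ) : ℂ) ^ z ∂μG)
    (g := fun σ : ℝ => ∫ x, h x * ((borelHeight x : ℝ≥0) : ℝ) ^ σ ∂μG)
    (tendsto_integral_mul_borelHeight_rpow_atTop μG hh hhs h0 hg₀ hH) (fun σ => integral_ofReal_mul_cpow_ofReal μG h σ)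
  have hWo : IsOpen (ball (0 : ℂ) (n + 2) ∩ {z : ℂ | σ₀ < z.re}) := isOpen_ball.inter (isOpen_lt continuous_const Complex.continuous_re)
  have hWne : (ball (0 : ℂ) (n + 2) ∩ {z : ℂ | σ₀ < z.re}).Nonempty := by
    -- the real midpoint of `m := max σ₀ (−(n+2))` and `n + 2`
    set m : ℝ := max σ₀ (-((n : ℝ) + 2)) with hm
    have hm1 : m < (n : ℝ) + 2 := max_lt hσ₀ (by have : (0 : ℝ) ≤ n := Nat.cast_nonneg n; linarith)
    have hmσ : σ₀ ≤ m := le_max_left _ _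
    have hmn : -((n : ℝ) + 2) ≤ m := le_max_right _ _
    refine ⟨(((m + ((n : ℝ) + 2)) / 2 : ℝ) : ℂ), ?_, ?_⟩
    · rw [Metric.mem_ball, dist_zero_right, Complex.norm_real, Real.norm_eq_abs, abs_lt]
      constructor <;> linarith
    · show σ₀ < ((((m + ((n : ℝ) + 2)) / 2 : ℝ) : ℂ)).re
      rw [Complex.ofReal_re]; linarith
  obtain ⟨z, hz, hzim⟩ := exists_mem_im_ne_zero_of_differentiable hent hnc hWo hWne
  exact ⟨z, hz, hzim⟩

omit [MeasurableSpace (quasiSplit F E c 3).Adelic] [BorelSpace (quasiSplit F E c 3).Adelic] [NeZero N] [MeasurableSpace (quasiSplit F E c N).Adelic]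
  [BorelSpace (quasiSplit F E c N).Adelic] in
/-- **`N = 2`, any threshold** (`c² = 1`; ★ P6 `one_mem_closure_setOf_one_lt_borelHeight_two`): `U₀(σ₀, n) ≠ ∅` from `h(1) ≠ 0`. [cite: BernsteinLapid2019, §4 Claim 1 and Thm 2.3] -/
theorem uniqueSetSA_nonempty_two_of_lt (hc : c * c = 1) [MeasurableSpace (quasiSplit F E c 2).Adelic] [BorelSpace (quasiSplit F E c 2).Adelic]
    (μG : Measure (quasiSplit F E c 2).Adelic) [IsFiniteMeasureOnCompacts μG] [μG.IsOpenPosMeasure]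
    {h : (quasiSplit F E c 2).Adelic → ℝ} (hh : Continuous h) (hhs : HasCompactSupport h) (h0 : ∀ x, 0 ≤ h x) (hh1 : h 1 ≠ 0) (σ₀ : ℝ) (n : ℕ) (hσ₀ : σ₀ < n + 2) :
    (ball (0 : ℂ) (n + 2) ∩ {z : ℂ | σ₀ < z.re} ∩ {z : ℂ | (∫ x, (h x : ℂ) * (((borelHeight x : ℝ≥0) : ℝ) : ℂ) ^ z ∂μG).im ≠ 0}).Nonempty := by
  obtain ⟨g₀, hg₀, hH⟩ := exists_ne_zero_one_lt_borelHeight hh hh1 (one_mem_closure_setOf_one_lt_borelHeight_two hc)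
  exact uniqueSetSA_nonempty_of_lt μG hh hhs h0 hg₀ hH σ₀ n hσ₀

/-- **`N = 3`, any threshold** (no `c² = 1`; §1 `one_mem_closure_setOf_one_lt_borelHeight_three`): `U₀(σ₀, n) ≠ ∅` from `h(1) ≠ 0` — the shape P8₃ consumes with the symmetric
test functions `h_i = η_i^∨ ∗ η_i` (`h_i ≥ 0`, `h_i(1) > 0`) and `σ₀ = 2`. [cite: BernsteinLapid2019, §4 Claim 1 and Thm 2.3] -/
theorem uniqueSetSA_nonempty_three_of_lt (μG : Measure (quasiSplit F E c 3).Adelic) [IsFiniteMeasureOnCompacts μG] [μG.IsOpenPosMeasure]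
    {h : (quasiSplit F E c 3).Adelic → ℝ} (hh : Continuous h) (hhs : HasCompactSupport h) (h0 : ∀ x, 0 ≤ h x) (hh1 : h 1 ≠ 0) (σ₀ : ℝ) (n : ℕ) (hσ₀ : σ₀ < n + 2) :
    (ball (0 : ℂ) (n + 2) ∩ {z : ℂ | σ₀ < z.re} ∩ {z : ℂ | (∫ x, (h x : ℂ) * (((borelHeight x : ℝ≥0) : ℝ) : ℂ) ^ z ∂μG).im ≠ 0}).Nonempty := by
  obtain ⟨g₀, hg₀, hH⟩ := exists_ne_zero_one_lt_borelHeight hh hh1 one_mem_closure_setOf_one_lt_borelHeight_three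
  exact uniqueSetSA_nonempty_of_lt μG hh hhs h0 hg₀ hH σ₀ n hσ₀

end UniqueSetThreshold

end Summit.HodgeConjecture.HodgeConjecture.Cruxes.H413.K2E1BLUniquenessU3

end
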